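import Summits.Ventures.PercRepro.C041ZoneZFDefs

/-!
# THEOREM Z′ — blue isolation and the transfer principles on the free edges (p6, gen 27; C-041.md §13)

Setting of `C041ZoneZFDefs`.  For a forced state: a blue edge from a vertex outside `iso` ends outside `iso` and is
free (`not_mem_iso_of_blueAdj`, `free_of_blue_of_end_not_mem`, `freeBlueAdj_of_blueAdj`); the marks and the deleted
set lie outside `iso` (`Bl_subset_iso_compl`, `Blt_subset_iso_compl`, `D_subset_iso_compl`).  AGREEMENT for the maps
on the free edges (`reach_dualF_eq`, `reach_flipOutF_eq`, `P_dualF_eq`, `P_flipOutF_eq`, `D_flipOutF_eq`,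
`CmixF_dualF_eq`) and COMPLEMENT on the free edges (`freeRedAdj_dualF_iff`, `freeRedAdj_of_blueAdj_dualF`,
`mixedAdjF_dualF_iff` = «the mixed adjacency relative to `P` of the dual outside `P` is the red adjacency»,
`mixedAdjF_of_freeBlueAdj`).
-/

namespace PercRepro

namespace ZoneZ

namespace FZone

open ZoneData

variable {V E T₁ T₂ : Type*} (F : FZone V E T₁ T₂) (Q A : Set V)

/-! ## Blue isolation -/

/-- For a forced state, a blue edge from a vertex outside `iso` ends outside `iso`. -/
theorem not_mem_iso_of_blueAdj {σ : State E T₁ T₂} (hF : F.Forced σ) {u v : V} (hu : u ∉ F.iso)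
    (h : F.BlueAdj σ u v) : v ∉ F.iso := by
  intro hv
  obtain ⟨e, hj, hc⟩ := h
  have hnf : ¬ F.free e := F.iso_forced e (F.touches_of_joins_left hj.symm hv)
  have hcol : F.fcol e = false := by
    rw [← hF e hnf]
    exact hc
  have hin := F.fblue_mem e hnf hcol
  rcases hj with ⟨h1, _⟩ | ⟨_, h2⟩
  · exact hu (h1 ▸ hin.1)
  · exact hu (h2 ▸ hin.2)

/-- For a forced state, a blue edge with an end outside `iso` is free. -/
theorem free_of_blue_of_end_not_mem {σ : State E T₁ T₂} (hF : F.Forced σ) {e : E} (hc : σ.1 e = false)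
    (h : F.fst e ∉ F.iso ∨ F.snd e ∉ F.iso) : F.free e := by
  by_contra hnf
  have hcol : F.fcol e = false := by
    rw [← hF e hnf]
    exact hc
  have hin := F.fblue_mem e hnf hcol
  rcases h with h | h
  · exact h hin.1
  · exact h hin.2

/-- A blue edge from a vertex outside `iso` is a free blue edge. -/
theorem freeBlueAdj_of_blueAdj {σ : State E T₁ T₂} (hF : F.Forced σ) {u v : V} (hu : u ∉ F.iso)
    (h : F.BlueAdj σ u v) : F.FreeBlueAdj σ u v := by
  obtain ⟨e, hj, hc⟩ := h
  refine ⟨e, hj, F.free_of_blue_of_end_not_mem hF hc ?_, hc⟩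
  rcases hj with ⟨h1, _⟩ | ⟨_, h2⟩
  · exact Or.inl (h1 ▸ hu)
  · exact Or.inr (h2 ▸ hu)

/-- A free blue edge is a blue edge. -/
theorem blueAdj_of_freeBlueAdj {σ : State E T₁ T₂} {u v : V} (h : F.FreeBlueAdj σ u v) : F.BlueAdj σ u v := by
  obtain ⟨e, hj, _, hc⟩ := h
  exact ⟨e, hj, hc⟩

/-- The blockers lie outside `iso`. -/
theorem Bl_subset_iso_compl (σ : State E T₁ T₂) : F.Bl σ ⊆ F.isoᶜ := by
  rintro v ⟨t, ht, _⟩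
  rw [← ht]
  exact F.iso_unmarked₁ t

/-- The red-`1`-marked vertices lie outside `iso`. -/
theorem Blt_subset_iso_compl (σ : State E T₁ T₂) : F.Blt σ ⊆ F.isoᶜ := by
  rintro v ⟨t, ht, _⟩
  rw [← ht]
  exact F.iso_unmarked₁ t

/-- The deleted set lies outside `iso`. -/
theorem D_subset_iso_compl {σ : State E T₁ T₂} (hF : F.Forced σ) : F.D σ ⊆ F.isoᶜ :=
  reach_subset_of_closed (F.Bl_subset_iso_compl σ) fun _ _ hu h => F.not_mem_iso_of_blueAdj hF hu h

/-! ## AGREEMENT for the maps on the free edges -/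

/-- A dual outside a set containing the reach of `S` preserves that reach. -/
theorem reach_dualF_eq {cond : E → Bool → Prop} (X : Set V) (σ : State E T₁ T₂) {S : Set V}
    (hX : reach (F.Adj cond σ) S ⊆ X) : reach (F.Adj cond (F.dualF X σ)) S = reach (F.Adj cond σ) S :=
  F.reach_eq_of_agree hX fun _ he => F.dualF_fst_of_touches X σ he

/-- A complement outside a set containing the reach of `S` preserves that reach. -/
theorem reach_flipOutF_eq {cond : E → Bool → Prop} (X : Set V) (σ : State E T₁ T₂) {S : Set V}
    (hX : reach (F.Adj cond σ) S ⊆ X) : reach (F.Adj cond (F.flipOutF X σ)) S = reach (F.Adj cond σ) S :=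
  F.reach_eq_of_agree hX fun _ he => F.flipOutF_fst_of_touches X σ he

/-- `P` is preserved by a dual outside a set containing it. -/
theorem P_dualF_eq (X : Set V) (σ : State E T₁ T₂) (hX : F.P Q σ ⊆ X) : F.P Q (F.dualF X σ) = F.P Q σ :=
  F.reach_dualF_eq X σ hX

/-- `P` is preserved by a complement outside a set containing it. -/
theorem P_flipOutF_eq (X : Set V) (σ : State E T₁ T₂) (hX : F.P Q σ ⊆ X) : F.P Q (F.flipOutF X σ) = F.P Q σ :=
  F.reach_flipOutF_eq X σ hX

/-- `D` is preserved by a complement outside a set containing it. -/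
theorem D_flipOutF_eq (X : Set V) (σ : State E T₁ T₂) (hX : F.D σ ⊆ X) : F.D (F.flipOutF X σ) = F.D σ := by
  unfold ZoneData.D
  rw [F.Bl_flipOutF]
  exact F.reach_flipOutF_eq X σ hX

/-- `C` is preserved by a dual outside a set containing `C` and `P`. -/
theorem CmixF_dualF_eq (X : Set V) (σ : State E T₁ T₂) (hP : F.P Q σ ⊆ X) (hC : F.CmixF Q A σ ⊆ X) :
    F.CmixF Q A (F.dualF X σ) = F.CmixF Q A σ := by
  unfold CmixF
  rw [F.P_dualF_eq Q X σ hP]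
  exact F.reach_dualF_eq X σ hC

/-! ## COMPLEMENT on the free edges -/

/-- Between two vertices outside `X` the free red adjacency of the dual is the free blue adjacency. -/
theorem freeRedAdj_dualF_iff (X : Set V) (σ : State E T₁ T₂) {u v : V} (hu : u ∉ X) (hv : v ∉ X) :
    F.FreeRedAdj (F.dualF X σ) u v ↔ F.FreeBlueAdj σ u v := by
  constructor <;> rintro ⟨e, hj, hf, hc⟩ <;> refine ⟨e, hj, hf, ?_⟩
  · rw [F.dualF_fst_of_free X σ hf (F.not_touches_of_joins hj hu hv)] at hc
    cases h : σ.1 e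
    · rfl
    · rw [h] at hc
      exact absurd hc (by decide)
  · rw [F.dualF_fst_of_free X σ hf (F.not_touches_of_joins hj hu hv), hc]
    rfl

/-- Between two vertices outside `X` the blue adjacency of the dual is the free red adjacency, for the free edges. -/
theorem freeRedAdj_of_blueAdj_dualF (X : Set V) (σ : State E T₁ T₂) {u v : V} (hu : u ∉ X) (hv : v ∉ X)
    {e : E} (hj : F.Joins e u v) (hf : F.free e) (hc : (F.dualF X σ).1 e = false) : F.FreeRedAdj σ u v := by
  refine ⟨e, hj, hf, ?_⟩
  rw [F.dualF_fst_of_free X σ hf (F.not_touches_of_joins hj hu hv)] at hc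
  cases h : σ.1 e
  · rw [h] at hc
    exact absurd hc (by decide)
  · rfl

/-- The mixed adjacency relative to `P` of the dual outside `P` is the red adjacency. -/
theorem mixedAdjF_dualF_iff (P : Set V) (σ : State E T₁ T₂) (u v : V) :
    F.MixedAdjF P (F.dualF P σ) u v ↔ F.RedAdj σ u v := by
  constructor
  · rintro ⟨e, hj, hc⟩
    refine ⟨e, hj, ?_⟩
    rcases hc with ⟨hf, ht, hc⟩ | ⟨hk, hc⟩
    · rw [F.dualF_fst_of_free P σ hf ht] at hc
      cases h : σ.1 e
      · rw [h] at hc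
        exact absurd hc (by decide)
      · rfl
    · rcases hk with hk | hk
      · rwa [F.dualF_fst_of_not_free P σ hk] at hc
      · rwa [F.dualF_fst_of_touches P σ hk] at hc
  · rintro ⟨e, hj, hc⟩
    refine ⟨e, hj, ?_⟩
    by_cases hf : F.free e
    · by_cases ht : F.Touches P e
      · right
        rw [F.dualF_fst_of_touches P σ ht]
        exact ⟨Or.inr ht, hc⟩
      · left
        rw [F.dualF_fst_of_free P σ hf ht, hc]
        exact ⟨hf, ht, rfl⟩
    · right
      rw [F.dualF_fst_of_not_free P σ hf]
      exact ⟨Or.inl hf, hc⟩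

/-- A free blue edge not touching `P` is a mixed adjacency. -/
theorem mixedAdjF_of_freeBlueAdj {P : Set V} {σ : State E T₁ T₂} {u v : V} (h : F.FreeBlueAdj σ u v)
    (hu : u ∉ P) (hv : v ∉ P) : F.MixedAdjF P σ u v := by
  obtain ⟨e, hj, hf, hc⟩ := h
  exact ⟨e, hj, Or.inl ⟨hf, F.not_touches_of_joins hj hu hv, hc⟩⟩

end FZone

end ZoneZ

end PercRepro
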